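import Literature.InformationTheory.QuantumCodes.CSSParameters
import HarnessLib

/-!
# `d_Z` of a `k = 1` CSS code from `L` disjoint, stabilizer-equivalent representatives of the logical `X̄`

Topic `InformationTheory/QuantumCodes`; namespace `Literature.InformationTheory.QuantumCodes.CSSCode`.
LADDER-QEC (cell `qec`), PARTITION row 08, item 08.RSC (generic engine of the rotated-surface-code distance proof,
`RotatedSurfaceCode*.lean`; usable for any `k = 1` CSS code).

The standard «`d` disjoint logical representatives» argument for surface codes (Dennis–Kitaev–Landahl–Preskill §3.2:
the `L` columns of a planar code are equivalent representatives of one logical operator, so a conjugate logical must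
cross each of them; Bombin–Martin-Delgado 2007), in a homology-free form. DATA: a CSS code `C` with `k = 1`; vectors
`ℓ₀, …, ℓ_{L−1}` with pairwise disjoint supports such that consecutive ones differ by an `X`-stabilizer
(`ℓ_j + ℓ_{j+1} ∈ rs H_X`) and `H_Z ℓ₀ = 0`; a vector `t` with `H_X t = 0`, `⟨t, ℓ₀⟩ = 1`, `|t| ≤ L`. CONCLUSION
(`dZ_eq_of_disjoint_lines`): `d_Z(C) = L`. Proof: `z ↦ ⟨z, ℓ_j⟩` is the same linear functional `φ` on `ker H_X` for
every `j`; `φ` kills `rs H_Z`; since `dim ker H_X = dim rs H_Z + k = dim rs H_Z + 1` and `φ(t) = 1`, the kernel of `φ` on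
`ker H_X` is exactly `rs H_Z`; hence every `Z`-logical has `φ = 1` at every `ℓ_j`, i.e. meets each of the `L` disjoint
supports — weight `≥ L` (`le_hammingNorm_of_disjoint_lines`) — and `t` is a `Z`-logical of weight `≤ L`.

0 named facts, no instances, no notation; axioms standard.

## References
* [DennisEtAl2002] Dennis–Kitaev–Landahl–Preskill, J. Math. Phys. 43 (2002), §3.2 Planar codes (chunk p0009 L9: «the
  shortest paths from rough edge to rough edge … contain L links»; the columns are the equivalent logical paths).
* [BombinMartinDelgado2007Optimal] H. Bombin, M. A. Martin-Delgado, PRA 76 (2007) 012305 = arXiv:quant-ph/0703272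
  (p0007 L1-9: planar surface codes with `n/d² = 1`).
-/

namespace Literature.InformationTheory.QuantumCodes

open Matrix

namespace CSSCode

variable {RX RZ Q : Type*} [Fintype RX] [Fintype RZ] [Fintype Q]

omit [Fintype RZ] in
/-- **Consecutive representatives give the same pairing**: if `ℓ_j + ℓ_{j+1} ∈ rs H_X` for consecutive `j`, then for
`z ∈ ker H_X` the parity `⟨z, ℓ_j⟩` does not depend on `j`.
[cite: DennisEtAl2002, §3.2 (the logical paths of a planar code are equivalent up to stabilizers)] -/
theorem dotProduct_line_eq (C : CSSCode RX RZ Q) {L : ℕ} (ℓ : Fin L → Q → ZMod 2)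
    (hstrip : ∀ (j j' : Fin L), j'.val = j.val + 1 → ℓ j + ℓ j' ∈ C.rowSpX) {z : Q → ZMod 2}
    (hz : C.HX *ᵥ z = 0) (j : Fin L) (h0 : 0 < L) : z ⬝ᵥ ℓ j = z ⬝ᵥ ℓ ⟨0, h0⟩ := by
  obtain ⟨jv, hj⟩ := j
  induction jv with
  | zero => rfl
  | succ m ih =>
    have hm : m < L := by omega
    have hs := hstrip ⟨m, hm⟩ ⟨m + 1, hj⟩ rfl
    have h := dotProduct_eq_zero_of_mem_rowSpace hs hz
    rw [dotProduct_add] at h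
    rw [← ih hm]
    exact (CharTwo.add_eq_zero.1 (by rwa [add_comm] at h))

/-- **Weight from disjoint odd pairings**: if `z` pairs to a non-zero value with each of `L` vectors with pairwise
disjoint supports, then `|z| ≥ L`. [cite: DennisEtAl2002, §3.2 (chunk p0009 L9: a logical path must contain at least L links)] -/
theorem le_hammingNorm_of_disjoint_lines {L : ℕ} (ℓ : Fin L → Q → ZMod 2)
    (hdisj : ∀ j j' : Fin L, j ≠ j' → ∀ q, ℓ j q = 0 ∨ ℓ j' q = 0) {z : Q → ZMod 2}
    (hodd : ∀ j, z ⬝ᵥ ℓ j ≠ 0) : L ≤ hammingNorm z := by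
  classical
  -- for each `j` pick a qubit in `supp z ∩ supp ℓ_j`
  have hex : ∀ j : Fin L, ∃ q, z q ≠ 0 ∧ ℓ j q ≠ 0 := by
    intro j
    obtain ⟨q, -, hq⟩ := Finset.exists_ne_zero_of_sum_ne_zero (hodd j)
    exact ⟨q, left_ne_zero_of_mul hq, right_ne_zero_of_mul hq⟩
  choose f hf using hex
  have hinj : Function.Injective f := by
    intro j j' h
    by_contra hne
    rcases hdisj j j' hne (f j) with h0 | h0
    · exact (hf j).2 h0
    · exact (hf j').2 (h ▸ h0)
  calc L = Fintype.card (Fin L) := (Fintype.card_fin L).symm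
    _ = (Finset.univ.image f).card := (Finset.card_image_of_injective _ hinj).symm
    _ ≤ (Finset.univ.filter fun q => z q ≠ 0).card := by
        refine Finset.card_le_card fun q hq => ?_
        obtain ⟨j, -, rfl⟩ := Finset.mem_image.1 hq
        simpa using (hf j).1
    _ = hammingNorm z := rfl

/-- **`d_Z = L` from `L` disjoint equivalent representatives (k = 1).** Let `C` be a CSS code with `k = 1`,
`ℓ₀, …, ℓ_{L−1}` (`L ≥ 1`) vectors with pairwise disjoint supports, consecutive ones differing by an `X`-stabilizer,
`H_Z ℓ₀ = 0`, and `t` with `H_X t = 0`, `⟨t, ℓ₀⟩ = 1`, `|t| ≤ L`. Then `d_Z(C) = L`.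
[cite: DennisEtAl2002, §3.2 (chunk p0009 L9: «A code with distance L is obtained … if the shortest paths from rough edge to rough edge … contain L links»)] [cite: BombinMartinDelgado2007Optimal, §IV (p0007 L1-9: planar surface codes, n/d² = 1)] -/
theorem dZ_eq_of_disjoint_lines (C : CSSCode RX RZ Q) {L : ℕ} (hL : 0 < L) (ℓ : Fin L → Q → ZMod 2)
    (hdisj : ∀ j j' : Fin L, j ≠ j' → ∀ q, ℓ j q = 0 ∨ ℓ j' q = 0)
    (hstrip : ∀ (j j' : Fin L), j'.val = j.val + 1 → ℓ j + ℓ j' ∈ C.rowSpX)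
    (hℓZ : C.HZ *ᵥ ℓ ⟨0, hL⟩ = 0) (t : Q → ZMod 2) (ht : C.HX *ᵥ t = 0) (ht1 : t ⬝ᵥ ℓ ⟨0, hL⟩ = 1)
    (htw : hammingNorm t ≤ L) (hk : C.k = 1) : C.dZ = L := by
  -- the functional `φ = ⟨·, ℓ₀⟩`
  set φ : (Q → ZMod 2) →ₗ[ZMod 2] ZMod 2 := dotProductBilin (ZMod 2) (ZMod 2) (ℓ ⟨0, hL⟩)
  have hφ : ∀ z, φ z = z ⬝ᵥ ℓ ⟨0, hL⟩ := fun z =>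
    show ℓ ⟨0, hL⟩ ⬝ᵥ z = z ⬝ᵥ ℓ ⟨0, hL⟩ from dotProduct_comm _ _
  -- `W = ker H_X ∩ ker φ` contains `rs H_Z` and misses `t`
  set W : Submodule (ZMod 2) (Q → ZMod 2) := C.kerX ⊓ LinearMap.ker φ with hW
  have hZW : C.rowSpZ ≤ W := by
    intro v hv
    refine Submodule.mem_inf.2 ⟨C.rowSpZ_le_kerX hv, ?_⟩
    rw [LinearMap.mem_ker, hφ, dotProduct_comm]
    exact dotProduct_eq_zero_of_mem_rowSpace hv hℓZ
  have htker : t ∈ C.kerX := ht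
  have htW : t ∉ W := by
    intro h
    have h2 := (Submodule.mem_inf.1 h).2
    rw [LinearMap.mem_ker, hφ, ht1] at h2
    exact one_ne_zero h2
  -- dimensions: `dim ker H_X = dim rs H_Z + 1`
  have hdim : Module.finrank (ZMod 2) C.kerX = Module.finrank (ZMod 2) C.rowSpZ + 1 := by
    have h1 := rank_add_finrank_pcCode C.HX
    have h2 := finrank_rowSpace_eq_rank C.HZ
    have h3 := C.k_eq
    have h4 := C.rank_HX_add_rank_HZ_le
    change C.HX.rank + Module.finrank (ZMod 2) C.kerX = Fintype.card Q at h1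
    change Module.finrank (ZMod 2) C.rowSpZ = C.HZ.rank at h2
    omega
  have hWlt : W < C.kerX := by
    refine lt_of_le_of_ne inf_le_left fun h => htW ?_
    rw [h]; exact htker
  have hWeq : W = C.rowSpZ := by
    refine (Submodule.eq_of_le_of_finrank_le hZW ?_).symm
    have := Submodule.finrank_lt_finrank_of_lt hWlt
    omega
  -- every Z-logical pairs oddly with every line
  have hlow : ∀ z : Q → ZMod 2, C.HX *ᵥ z = 0 → z ∉ C.rowSpZ → L ≤ hammingNorm z := by
    intro z hz hz'
    have hφz : z ⬝ᵥ ℓ ⟨0, hL⟩ ≠ 0 := by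
      intro h0
      apply hz'
      rw [← hWeq]
      exact Submodule.mem_inf.2 ⟨hz, by rw [LinearMap.mem_ker, hφ, h0]⟩
    refine le_hammingNorm_of_disjoint_lines ℓ hdisj fun j => ?_
    rw [C.dotProduct_line_eq ℓ hstrip hz j hL]
    exact hφz
  have ht' : t ∉ C.rowSpZ := by rw [← hWeq]; exact htW
  exact C.dZ_eq_of_witness ht ht' (le_antisymm htw (hlow t ht ht')) hlow

end CSSCode

end Literature.InformationTheory.QuantumCodes
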